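import Literature.NumberTheory.Automorphic.UnitIdeleArchPushforward
import Literature.NumberTheory.Automorphic.IdeleUnitBoxShells
import Literature.NumberTheory.GaloisRepresentations.HeckeCharacterProofs
import HarnessLib

/-!
# Integration over the `S`-unit box of the ideles in archimedean × `S`-adic coordinates:
`∫_{B(Sᶜ)} H(a_∞, (a_v)_{v ∈ S}) dν(a) = c ∫ H d(Haar on K_∞ˣ × ∏_{v ∈ S} K_vˣ)`

Topic `NumberTheory/Automorphic`; namespace `Literature.NumberTheory.Automorphic`. Theorems only (no
definition, no named fact, no instance). The finitely-many-bad-places version of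
`UnitIdeleArchPushforward` (`∫_{𝕌_K} H(a_∞) dν(a) = c ∫_{K_∞ˣ} H`, the case `S = ∅`): the step of every
Euler factorisation of an idelic integral in which the integral over the ideles that are units off a
finite set `S` of finite places,

  `B(Sᶜ) = {a ∈ 𝕀_K | a_w ∈ 𝒪_wˣ for all finite w ∉ S} = K_∞ˣ × ∏_{v ∈ S} K_vˣ × ∏_{w ∉ S} 𝒪_wˣ`
  (`ideleUnitBox {w | w ∉ S}` of `IdeleUnitBoxShells`),

of a function of the archimedean and `S`-adic coordinates only is computed as an integral over the
locally compact group `K_∞ˣ × ∏_{v ∈ S} K_vˣ` (Tate (1967), §4.3–§4.4, the passage from `𝕀_K` to the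
finite products `𝕀_S = ∏_{v ∈ S ∪ ∞} K_vˣ × ∏_{v ∉ S} 𝒪_vˣ`: "the restriction to `𝕀_S` of the Haar
measure of `𝕀_K` is the product measure"; Weil, *Basic Number Theory*, Ch. VII §4). In the tree's
vocabulary, with the coordinate map

  `Θ_S(a) = (archUnitsOfIdele K a, (finComp v a)_{v ∈ S}) ∈ K_∞ˣ × ∏_{v ∈ S} K_vˣ`

(`archUnitsOfIdele` of `UnitIdeleArchPushforward`, `ideleGroup.finComp` of `HeckeCharacterProofs` made
unit-valued by `MonoidHom.toHomUnits`):

* `exists_map_restrict_ideleUnitBox_compl_eq_smul` (**main**) — for a left-invariant measure `ν` on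
  `𝕀_K` finite on compact sets and ANY Haar measure `μ` on `K_∞ˣ × ∏_{v ∈ S} K_vˣ` there is `c ∈ ℝ≥0`
  with `(Θ_S)_* (ν|_{B(Sᶜ)}) = c • μ`. Proof: the pushforward is left-invariant (every element of the
  target lifts to an element of `B(Sᶜ)` — an archimedean idele times local ideles at the places of `S` —
  under which `B(Sᶜ)` and `ν` are invariant) and finite on compact sets (it is finite on the open set
  `{(x, y) | ‖x_w‖, ‖x_w⁻¹‖ < R, y_v ∈ 𝒪_vˣ}`, whose preimage in `B(Sᶜ)` lies in the compact box of unit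
  ideles of bounded archimedean size of `UnitIdeleArchimedeanIntegration`, and a left-invariant measure
  finite on one non-empty open set is finite on compact sets, `isFiniteMeasureOnCompacts_of_isOpen`),
  hence a multiple of `μ` by the uniqueness of Haar measure (`Measure.isMulLeftInvariant_eq_smul`);
* `exists_setLIntegral_ideleUnitBox_compl_eq_mul_lintegral`,
  `exists_setIntegral_ideleUnitBox_compl_eq_mul_integral` — the same as identities of lower Lebesgue
  and of Bochner integrals, `∫_{B(Sᶜ)} H(Θ_S a) dν(a) = c ∫ H dμ`, ONE constant for all `H`;
* `ne_zero_of_map_restrict_ideleUnitBox_compl_eq_smul` — `c ≠ 0` as soon as `ν` charges non-empty open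
  sets (e.g. `ν` a Haar measure).

With `μ = μ_∞ ⊗ ⊗_{v ∈ S} μ_v` a product of Haar measures, Fubini (`integral_prod_mul`,
`integral_fintype_prod_eq_prod`) turns the right side for a product function
`H(x, y) = g(x) ∏_{v ∈ S} h_v(y_v)` into `c · ∫ g dμ_∞ · ∏_{v ∈ S} ∫ h_v dμ_v` — the local zeta integrals
at the archimedean and at the bad finite places of an Euler product (consumers: the Euler factorisation
of the global Hecke / Rankin–Selberg integrals of pure tensors with honest local factors at the places
of `S`, `FinWhittakerProductFormula`, `StandardLTheoryGL2OfArchTestVectorAndEulerFactorisation`).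

## References

* J. Tate, *Fourier analysis in number fields and Hecke's zeta-functions*, in Cassels–Fröhlich,
  *Algebraic Number Theory* (1967), Ch. XV, §4.3–§4.4 [CasselsFrohlichANT1967].
* A. Weil, *Basic Number Theory*, 3rd ed. (1974), Ch. VII §4.
-/

noncomputable section

open MeasureTheory Measure NumberField IsDedekindDomain Set Filter Topology NumberField.InfinitePlace
open NumberField.mixedEmbedding
open Literature.NumberTheory.GaloisRepresentations (ideleGroup unitIdeles localUnits)
open scoped ENNReal NNReal Pointwise Classical

namespace Literature.NumberTheory.Automorphic

/-! ### 1. A left-invariant measure finite on one non-empty open set is finite on compact sets -/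

section General

variable {G : Type*} [Group G] [TopologicalSpace G] [IsTopologicalGroup G] [MeasurableSpace G]
  [BorelSpace G]

/-- **A left-invariant Borel measure which is finite on a non-empty open set is finite on every compact
set**: a compact set is covered by finitely many left translates of the open set, each of the same
measure. [folklore] -/
theorem isFiniteMeasureOnCompacts_of_isOpen (μ : Measure G) [μ.IsMulLeftInvariant] {U : Set G}
    (hU : IsOpen U) (hne : U.Nonempty) (hfin : μ U < ∞) : IsFiniteMeasureOnCompacts μ := by
  refine ⟨fun C hC => ?_⟩
  obtain ⟨u₀, hu₀⟩ := hne
  -- the translates `g • U`, `g ∈ G`, cover `C`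
  have hcover : C ⊆ ⋃ g : G, (fun x => g * x) '' U := fun x _ =>
    Set.mem_iUnion.2 ⟨x * u₀⁻¹, ⟨u₀, hu₀, by simp⟩⟩
  have hopen : ∀ g : G, IsOpen ((fun x => g * x) '' U) := fun g => (Homeomorph.mulLeft g).isOpenMap U hU
  obtain ⟨T, hT⟩ := hC.elim_finite_subcover _ hopen hcover
  calc μ C ≤ μ (⋃ g ∈ T, (fun x => g * x) '' U) := measure_mono hT
    _ ≤ ∑ g ∈ T, μ ((fun x => g * x) '' U) := measure_biUnion_finset_le T _
    _ < ∞ := by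
        refine ENNReal.sum_lt_top.2 fun g _ => ?_
        have himage : (fun x => g * x) '' U = (fun x => g⁻¹ * x) ⁻¹' U := by
          ext x
          simp only [Set.mem_image, Set.mem_preimage]
          constructor
          · rintro ⟨y, hy, rfl⟩
            simpa using hy
          · intro hx
            exact ⟨g⁻¹ * x, hx, by simp⟩
        rw [himage, measure_preimage_mul]
        exact hfin

end General

/-! ### 2. The coordinate map `Θ_S` and its lifts -/

section Coordinates

variable {K : Type} [Field K] [NumberField K]

/-- The `v`-component of the local idele `ι_v(u)` as a unit is `u`. [folklore] -/
theorem toHomUnits_finComp_localUnits_self (v : HeightOneSpectrum (𝓞 K)) (u : (v.adicCompletion K)ˣ) :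
    (GaloisRepresentations.ideleGroup.finComp v).toHomUnits (localUnits v u) = u :=
  Units.ext (GaloisRepresentations.localUnits_snd_apply_self v u)

/-- The `w`-component of `ι_v(u)` at `w ≠ v` is `1`. [folklore] -/
theorem toHomUnits_finComp_localUnits_of_ne {v w : HeightOneSpectrum (𝓞 K)} (u : (v.adicCompletion K)ˣ)
    (h : w ≠ v) : (GaloisRepresentations.ideleGroup.finComp w).toHomUnits (localUnits v u) = 1 :=
  Units.ext (GaloisRepresentations.localUnits_snd_apply_of_ne u h)

/-- The archimedean coordinate of a local idele `ι_v(u)` is `1`. [folklore] -/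
theorem archUnitsOfIdele_localUnits (v : HeightOneSpectrum (𝓞 K)) (u : (v.adicCompletion K)ˣ) :
    archUnitsOfIdele K (localUnits v u) = 1 := by
  refine Units.ext ?_
  rw [coe_archUnitsOfIdele, GaloisRepresentations.localUnits_fst, map_one, Units.val_one]

/-- The finite components of the archimedean idele `(x, 1)` are `1`. [folklore] -/
theorem toHomUnits_finComp_infiniteIdeleOfMixed (x : (mixedSpace K)ˣ) (w : HeightOneSpectrum (𝓞 K)) :
    (GaloisRepresentations.ideleGroup.finComp w).toHomUnits (infiniteIdeleOfMixed x) = 1 := by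
  refine Units.ext ?_
  change ((infiniteIdeleOfMixed x : ideleGroup K) : AdeleRing (𝓞 K) K).2 w = 1
  unfold infiniteIdeleOfMixed
  rw [GaloisRepresentations.infiniteIdeles_snd]

/-- The valuation of the `w`-component of `ι_v(u)` at `w ≠ v` is `1`. [folklore] -/
theorem valued_localUnits_snd_of_ne {v w : HeightOneSpectrum (𝓞 K)} (u : (v.adicCompletion K)ˣ) (h : w ≠ v) :
    Valued.v (((localUnits v u : ideleGroup K) : AdeleRing (𝓞 K) K).2 w) = 1 := by
  rw [GaloisRepresentations.localUnits_snd_apply_of_ne u h, map_one]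

/-- If the `w`-component of an idele has valuation `1`, so has that of its inverse. [folklore] -/
theorem valued_inv_snd_eq_one {a : ideleGroup K} {w : HeightOneSpectrum (𝓞 K)}
    (h : Valued.v (((a : ideleGroup K) : AdeleRing (𝓞 K) K).2 w) = 1) :
    Valued.v ((((a⁻¹ : ideleGroup K)) : AdeleRing (𝓞 K) K).2 w) = 1 := by
  have hmul : ((a : ideleGroup K) : AdeleRing (𝓞 K) K).2 w * (((a⁻¹ : ideleGroup K)) : AdeleRing (𝓞 K) K).2 w = 1 := by
    rw [← GaloisRepresentations.ideleGroup_val_snd_mul, mul_inv_cancel]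
    rfl
  have h2 := congrArg Valued.v hmul
  rwa [map_mul, h, one_mul, map_one] at h2

/-- In a linearly ordered commutative group with zero, `x ≤ 1`, `y ≤ 1`, `x y = 1` force `x = 1`.
[folklore] -/
theorem eq_one_of_le_one_of_mul_eq_one {Γ₀ : Type*} [LinearOrderedCommGroupWithZero Γ₀] {x y : Γ₀}
    (hx : x ≤ 1) (hy : y ≤ 1) (hxy : x * y = 1) : x = 1 := by
  refine le_antisymm hx ?_
  calc (1 : Γ₀) = x * y := hxy.symm
    _ ≤ x * 1 := by gcongr
    _ = x := mul_one x

/-- Second countability of `K_vˣ` (units topology). [folklore] -/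
theorem secondCountableTopology_units_adicCompletion (v : HeightOneSpectrum (𝓞 K)) :
    SecondCountableTopology (v.adicCompletion K)ˣ := by
  haveI := secondCountableTopology_adicCompletion K v
  haveI : SecondCountableTopology (v.adicCompletion K)ᵐᵒᵖ := MulOpposite.opHomeomorph.symm.secondCountableTopology
  exact Units.isEmbedding_embedProduct.secondCountableTopology

/-- Continuity of the unit-valued `v`-component `𝕀_K → K_vˣ`. [folklore] -/
theorem continuous_toHomUnits_finComp (v : HeightOneSpectrum (𝓞 K)) :
    Continuous ((GaloisRepresentations.ideleGroup.finComp v).toHomUnits : ideleGroup K → (v.adicCompletion K)ˣ) := by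
  refine Units.continuous_iff.2 ⟨?_, ?_⟩
  · have h : (Units.val ∘ ((GaloisRepresentations.ideleGroup.finComp v).toHomUnits :
        ideleGroup K → (v.adicCompletion K)ˣ)) =
        fun x : ideleGroup K => ((x : ideleGroup K) : AdeleRing (𝓞 K) K).2 v := by
      funext x
      rfl
    rw [h]
    exact (RestrictedProduct.continuous_eval v).comp (continuous_snd.comp Units.continuous_val)
  · have h : (fun x : ideleGroup K => ((((GaloisRepresentations.ideleGroup.finComp v).toHomUnits x)⁻¹ :
        (v.adicCompletion K)ˣ) : v.adicCompletion K)) =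
        fun x : ideleGroup K => (((x⁻¹ : ideleGroup K)) : AdeleRing (𝓞 K) K).2 v := by
      funext x
      rw [← map_inv]
      rfl
    rw [h]
    exact (RestrictedProduct.continuous_eval v).comp (continuous_snd.comp (Units.continuous_val.comp continuous_inv))

end Coordinates

/-! ### 3. The pushforward of `ν|_{B(Sᶜ)}` under `Θ_S` is a Haar measure -/

section Pushforward

variable {K : Type} [Field K] [NumberField K]

variable [MeasurableSpace (ideleGroup K)] [BorelSpace (ideleGroup K)]
  [MeasurableSpace ((mixedSpace K)ˣ)] [BorelSpace ((mixedSpace K)ˣ)]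
  [∀ v : HeightOneSpectrum (𝓞 K), MeasurableSpace ((v.adicCompletion K)ˣ)]
  [∀ v : HeightOneSpectrum (𝓞 K), BorelSpace ((v.adicCompletion K)ˣ)]

variable (ν : Measure (ideleGroup K)) [IsFiniteMeasureOnCompacts ν] [ν.IsMulLeftInvariant]
  (S : Finset (HeightOneSpectrum (𝓞 K)))

/-- **`(Θ_S)_* (ν|_{B(Sᶜ)}) = c • μ`.** For a left-invariant measure `ν` on `𝕀_K` finite on compact sets,
a finite set `S` of finite places and a Haar measure `μ` on `K_∞ˣ × ∏_{v ∈ S} K_vˣ`, the image under the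
archimedean-and-`S`-adic coordinates `Θ_S(a) = (a_∞, (a_v)_{v ∈ S})` of `ν` restricted to the ideles
which are units off `S` is a constant multiple of `μ` (Tate (1967), §4.3: the Haar measure of `𝕀_K`
restricted to `𝕀_S` is the product measure). [cite: CasselsFrohlichANT1967, Ch. XV §4.3] -/
theorem exists_map_restrict_ideleUnitBox_compl_eq_smul
    (μ : Measure ((mixedSpace K)ˣ × (∀ v : ↥S, (v.1.adicCompletion K)ˣ))) [IsHaarMeasure μ] :
    ∃ c : ℝ≥0, (ν.restrict (ideleUnitBox {w | w ∉ S})).map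
        (fun a => (archUnitsOfIdele K a,
          fun v : ↥S => (GaloisRepresentations.ideleGroup.finComp v.1).toHomUnits a)) = c • μ := by
  set B : Set (ideleGroup K) := ideleUnitBox {w | w ∉ S} with hB
  have hBm : MeasurableSet B :=
    measurableSet_ideleUnitBox_compl (fun v => GaloisRepresentations.HeckeCharacter.uniformizer K v)
      (fun v => GaloisRepresentations.HeckeCharacter.valued_uniformizer v) S
  -- the coordinate map as a monoid homomorphism
  set Θh : ideleGroup K →* (mixedSpace K)ˣ × (∀ v : ↥S, (v.1.adicCompletion K)ˣ) :=
    (archUnitsOfIdele K).prod (MonoidHom.pi fun v : ↥S =>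
      (GaloisRepresentations.ideleGroup.finComp v.1).toHomUnits) with hΘh
  have hΘeq : (fun a => (archUnitsOfIdele K a,
      fun v : ↥S => (GaloisRepresentations.ideleGroup.finComp v.1).toHomUnits a)) = ⇑Θh := by
    funext a
    rfl
  rw [hΘeq]
  have hΘc : Continuous Θh := by
    refine continuous_archUnitsOfIdele.prodMk (continuous_pi fun v => ?_)
    exact continuous_toHomUnits_finComp v.1
  haveI : HasSummableGeomSeries (mixedSpace K) :=
    Literature.MeasureTheory.Group.hasSummableGeomSeries_of_finiteDimensional
  haveI : SecondCountableTopology (ideleGroup K) := secondCountableTopology_ideleGroup K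
  haveI : SecondCountableTopology (mixedSpace K)ˣ := Literature.MeasureTheory.Group.Units.secondCountableTopology
  haveI : ∀ v : ↥S, SecondCountableTopology (v.1.adicCompletion K)ˣ := fun v =>
    secondCountableTopology_units_adicCompletion v.1
  haveI : BorelSpace ((mixedSpace K)ˣ × (∀ v : ↥S, (v.1.adicCompletion K)ˣ)) := Prod.borelSpace
  have hΘm : Measurable Θh := hΘc.measurable
  haveI : MeasurableMul ((mixedSpace K)ˣ × (∀ v : ↥S, (v.1.adicCompletion K)ˣ)) := ContinuousMul.measurableMul
  set ρ : Measure ((mixedSpace K)ˣ × (∀ v : ↥S, (v.1.adicCompletion K)ˣ)) := (ν.restrict B).map Θh with hρ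
  -- lifts: `t(x, y) = (x, 1) · ∏_{v ∈ S} ι_v(y_v) ∈ B` with `Θ t = (x, y)`
  have hlift : ∀ p : (mixedSpace K)ˣ × (∀ v : ↥S, (v.1.adicCompletion K)ˣ), ∃ t ∈ B, Θh t = p ∧
      ∀ w ∉ S, Valued.v (((t : ideleGroup K) : AdeleRing (𝓞 K) K).2 w) = 1 := by
    rintro ⟨x, y⟩
    set t : ideleGroup K := infiniteIdeleOfMixed x * ∏ v ∈ S.attach, localUnits v.1 (y v) with ht
    have hval : ∀ w ∉ S, Valued.v (((t : ideleGroup K) : AdeleRing (𝓞 K) K).2 w) = 1 := by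
      intro w hw
      rw [ht, GaloisRepresentations.ideleGroup_val_snd_mul, map_mul,
        GaloisRepresentations.mem_unitIdeles_iff.1 (infiniteIdeleOfMixed_mem_unitIdeles x) w, one_mul,
        ideleGroup_val_snd_prod, map_prod]
      refine Finset.prod_eq_one fun v _ => valued_localUnits_snd_of_ne _ ?_
      rintro rfl
      exact hw v.2
    refine ⟨t, fun w hw => hval w hw, ?_, hval⟩
    refine Prod.ext ?_ (funext fun v => ?_)
    · change archUnitsOfIdele K t = x
      rw [ht, map_mul, archUnitsOfIdele_infiniteIdeleOfMixed, map_prod]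
      rw [Finset.prod_eq_one fun v _ => archUnitsOfIdele_localUnits v.1 (y v), mul_one]
    · change (GaloisRepresentations.ideleGroup.finComp v.1).toHomUnits t = y v
      rw [ht, map_mul, toHomUnits_finComp_infiniteIdeleOfMixed, one_mul, map_prod,
        Finset.prod_eq_single v]
      · exact toHomUnits_finComp_localUnits_self v.1 (y v)
      · intro w _ hwv
        exact toHomUnits_finComp_localUnits_of_ne (y w) fun h => hwv (Subtype.ext h.symm)
      · intro h
        exact absurd (Finset.mem_attach S v) h
  -- left invariance of `ρ`
  haveI : ρ.IsMulLeftInvariant := by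
    refine ⟨fun p => ?_⟩
    obtain ⟨t, htB, hΘt, htval⟩ := hlift p
    have hcomp : ((fun z => p * z) ∘ Θh) = Θh ∘ fun a => t * a := by
      funext a
      simp only [Function.comp_apply, map_mul, hΘt]
    have hpre : (fun a => t * a) ⁻¹' B = B := by
      ext a
      simp only [Set.mem_preimage, hB, ideleUnitBox, Set.mem_setOf_eq]
      refine forall₂_congr fun w hw => ?_
      rw [GaloisRepresentations.ideleGroup_val_snd_mul, map_mul, htval w hw, one_mul]
    rw [hρ, Measure.map_map (measurable_const_mul p) hΘm, hcomp, ← Measure.map_map hΘm (measurable_const_mul t)]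
    congr 1
    conv_lhs => rw [← hpre]
    rw [← Measure.restrict_map (measurable_const_mul t) hBm, map_mul_left_eq_self]
  -- `ρ` is finite on a non-empty open set, hence on compact sets
  haveI : IsFiniteMeasureOnCompacts ρ := by
    -- the open set `O = {(x, y) | ‖x_w‖ < 2, ‖x_w⁻¹‖ < 2, |y_v| = 1}`
    have hcont : ∀ w : InfinitePlace K, Continuous fun z : (mixedSpace K)ˣ =>
        ‖(InfiniteAdeleRing.ringEquiv_mixedSpace K).symm (z : mixedSpace K) w‖ := fun w =>
      (continuous_apply w |>.comp ((continuous_ringEquiv_mixedSpace_symm K).comp Units.continuous_val)).norm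
    have hcont' : ∀ w : InfinitePlace K, Continuous fun z : (mixedSpace K)ˣ =>
        ‖(InfiniteAdeleRing.ringEquiv_mixedSpace K).symm ((z⁻¹ : (mixedSpace K)ˣ) : mixedSpace K) w‖ := fun w =>
      (hcont w).comp continuous_inv
    have hcv : ∀ v : ↥S, Continuous fun p : (mixedSpace K)ˣ × (∀ v : ↥S, (v.1.adicCompletion K)ˣ) =>
        ((p.2 v : (v.1.adicCompletion K)ˣ) : v.1.adicCompletion K) := fun v =>
      Units.continuous_val.comp ((continuous_apply v).comp continuous_snd)
    have hcv' : ∀ v : ↥S, Continuous fun p : (mixedSpace K)ˣ × (∀ v : ↥S, (v.1.adicCompletion K)ˣ) =>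
        (((p.2 v)⁻¹ : (v.1.adicCompletion K)ˣ) : v.1.adicCompletion K) := fun v =>
      Units.continuous_val.comp (((continuous_apply v).comp continuous_snd).inv)
    set O : Set ((mixedSpace K)ˣ × (∀ v : ↥S, (v.1.adicCompletion K)ˣ)) :=
      (⋂ w : InfinitePlace K,
        ((fun p => ‖(InfiniteAdeleRing.ringEquiv_mixedSpace K).symm (p.1 : mixedSpace K) w‖) ⁻¹' Set.Iio 2 ∩
          (fun p => ‖(InfiniteAdeleRing.ringEquiv_mixedSpace K).symm ((p.1⁻¹ : (mixedSpace K)ˣ) : mixedSpace K) w‖) ⁻¹'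
            Set.Iio 2)) ∩
      ⋂ v : ↥S, ((fun p => ((p.2 v : (v.1.adicCompletion K)ˣ) : v.1.adicCompletion K)) ⁻¹'
          (v.1.adicCompletionIntegers K : Set (v.1.adicCompletion K)) ∩
        (fun p => (((p.2 v)⁻¹ : (v.1.adicCompletion K)ˣ) : v.1.adicCompletion K)) ⁻¹'
          (v.1.adicCompletionIntegers K : Set (v.1.adicCompletion K))) with hO
    have hOo : IsOpen O := by
      refine IsOpen.inter (isOpen_iInter_of_finite fun w => IsOpen.inter ?_ ?_)
        (isOpen_iInter_of_finite fun v => IsOpen.inter ?_ ?_)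
      · exact isOpen_Iio.preimage ((hcont w).comp continuous_fst)
      · exact isOpen_Iio.preimage ((hcont' w).comp continuous_fst)
      · exact (Valued.isOpen_valuationSubring (v.1.adicCompletion K)).preimage (hcv v)
      · exact (Valued.isOpen_valuationSubring (v.1.adicCompletion K)).preimage (hcv' v)
    have hnorm1 : ∀ w : InfinitePlace K, ‖(1 : InfiniteAdeleRing K) w‖ = 1 := fun w => by
      change ‖(1 : w.Completion)‖ = 1
      exact norm_one
    have hOne : (1 : (mixedSpace K)ˣ × (∀ v : ↥S, (v.1.adicCompletion K)ˣ)) ∈ O := by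
      refine ⟨Set.mem_iInter.2 fun w => ⟨?_, ?_⟩, Set.mem_iInter.2 fun v => ⟨?_, ?_⟩⟩
      · change ‖(InfiniteAdeleRing.ringEquiv_mixedSpace K).symm ((1 : (mixedSpace K)ˣ) : mixedSpace K) w‖ < 2
        rw [Units.val_one, map_one, hnorm1]
        exact one_lt_two
      · change ‖(InfiniteAdeleRing.ringEquiv_mixedSpace K).symm (((1 : (mixedSpace K)ˣ)⁻¹ : (mixedSpace K)ˣ) :
          mixedSpace K) w‖ < 2
        rw [inv_one, Units.val_one, map_one, hnorm1]
        exact one_lt_two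
      · change (((1 : ∀ v : ↥S, (v.1.adicCompletion K)ˣ) v : (v.1.adicCompletion K)ˣ) : v.1.adicCompletion K) ∈
          v.1.adicCompletionIntegers K
        rw [Pi.one_apply, Units.val_one]
        exact one_mem _
      · change ((((1 : ∀ v : ↥S, (v.1.adicCompletion K)ˣ) v)⁻¹ : (v.1.adicCompletion K)ˣ) : v.1.adicCompletion K) ∈
          v.1.adicCompletionIntegers K
        rw [Pi.one_apply, inv_one, Units.val_one]
        exact one_mem _
    have hfin : ρ O < ∞ := by
      rw [hρ, Measure.map_apply hΘm hOo.measurableSet, Measure.restrict_apply (hΘm hOo.measurableSet)]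
      set C : Set (ideleGroup K) := {x : ideleGroup K | x ∈ unitIdeles K ∧
        ∀ w : InfinitePlace K, ‖((x : ideleGroup K) : AdeleRing (𝓞 K) K).1 w‖ ≤ 2 ∧
          ‖((x⁻¹ : ideleGroup K) : AdeleRing (𝓞 K) K).1 w‖ ≤ 2} with hC
      have hCc : IsCompact C := isCompact_setOf_mem_unitIdeles_norm_le 2 2
      have hsub : Θh ⁻¹' O ∩ B ⊆ C := by
        rintro a ⟨haO, haB⟩
        obtain ⟨h1, h2⟩ := haO
        rw [Set.mem_iInter] at h1 h2
        refine ⟨?_, fun w => ?_⟩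
        · rw [GaloisRepresentations.mem_unitIdeles_iff]
          intro w
          by_cases hw : w ∈ S
          · obtain ⟨hint, hint'⟩ := h2 ⟨w, hw⟩
            rw [Set.mem_preimage, SetLike.mem_coe, HeightOneSpectrum.mem_adicCompletionIntegers] at hint hint'
            change Valued.v (((a : ideleGroup K) : AdeleRing (𝓞 K) K).2 w) ≤ 1 at hint
            change Valued.v ((((a⁻¹ : ideleGroup K)) : AdeleRing (𝓞 K) K).2 w) ≤ 1 at hint'
            refine eq_one_of_le_one_of_mul_eq_one hint hint' ?_
            rw [← map_mul, ← GaloisRepresentations.ideleGroup_val_snd_mul, mul_inv_cancel]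
            exact map_one _
          · exact haB w hw
        · obtain ⟨h1a, h1b⟩ := h1 w
          constructor
          · rw [norm_fst_eq_of_archUnitsOfIdele]
            exact (le_of_lt h1a)
          · rw [norm_fst_eq_of_archUnitsOfIdele, map_inv]
            exact (le_of_lt h1b)
      exact (measure_mono hsub).trans_lt hCc.measure_lt_top
    exact isFiniteMeasureOnCompacts_of_isOpen ρ hOo ⟨1, hOne⟩ hfin
  -- uniqueness of Haar measure
  exact ⟨haarScalarFactor ρ μ, isMulLeftInvariant_eq_smul ρ μ⟩

/-- **`∫⁻_{B(Sᶜ)} H(Θ_S a) dν(a) = c ∫⁻ H dμ`** for every measurable `H ≥ 0`, with ONE constant `c`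
(`exists_map_restrict_ideleUnitBox_compl_eq_smul` read on lower Lebesgue integrals).
[cite: CasselsFrohlichANT1967, Ch. XV §4.3] -/
theorem exists_setLIntegral_ideleUnitBox_compl_eq_mul_lintegral
    (μ : Measure ((mixedSpace K)ˣ × (∀ v : ↥S, (v.1.adicCompletion K)ˣ))) [IsHaarMeasure μ] :
    ∃ c : ℝ≥0, ∀ (H : (mixedSpace K)ˣ × (∀ v : ↥S, (v.1.adicCompletion K)ˣ) → ℝ≥0∞), Measurable H →
      ∫⁻ a in ideleUnitBox {w | w ∉ S}, H (archUnitsOfIdele K a,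
          fun v : ↥S => (GaloisRepresentations.ideleGroup.finComp v.1).toHomUnits a) ∂ν =
        c * ∫⁻ p, H p ∂μ := by
  haveI : HasSummableGeomSeries (mixedSpace K) :=
    Literature.MeasureTheory.Group.hasSummableGeomSeries_of_finiteDimensional
  haveI : SecondCountableTopology (ideleGroup K) := secondCountableTopology_ideleGroup K
  haveI : SecondCountableTopology (mixedSpace K)ˣ := Literature.MeasureTheory.Group.Units.secondCountableTopology
  haveI : ∀ v : ↥S, SecondCountableTopology (v.1.adicCompletion K)ˣ := fun v =>
    secondCountableTopology_units_adicCompletion v.1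
  haveI : BorelSpace ((mixedSpace K)ˣ × (∀ v : ↥S, (v.1.adicCompletion K)ˣ)) := Prod.borelSpace
  obtain ⟨c, hc⟩ := exists_map_restrict_ideleUnitBox_compl_eq_smul ν S μ
  have hΘm : Measurable (fun a : ideleGroup K => (archUnitsOfIdele K a,
      fun v : ↥S => (GaloisRepresentations.ideleGroup.finComp v.1).toHomUnits a)) :=
    (continuous_archUnitsOfIdele.prodMk (continuous_pi fun v => continuous_toHomUnits_finComp v.1)).measurable
  refine ⟨c, fun H hH => ?_⟩
  rw [← lintegral_map hH hΘm, hc, lintegral_smul_measure, ENNReal.smul_def, smul_eq_mul]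

/-- **`∫_{B(Sᶜ)} H(Θ_S a) dν(a) = c ∫ H dμ`** (Bochner integrals, `H` strongly measurable with values in
a Banach space), with the same constant for all `H`. [cite: CasselsFrohlichANT1967, Ch. XV §4.3] -/
theorem exists_setIntegral_ideleUnitBox_compl_eq_mul_integral
    (μ : Measure ((mixedSpace K)ˣ × (∀ v : ↥S, (v.1.adicCompletion K)ˣ))) [IsHaarMeasure μ]
    {E : Type*} [NormedAddCommGroup E] [NormedSpace ℝ E] :
    ∃ c : ℝ≥0, ∀ (H : (mixedSpace K)ˣ × (∀ v : ↥S, (v.1.adicCompletion K)ˣ) → E),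
      AEStronglyMeasurable H μ →
      ∫ a in ideleUnitBox {w | w ∉ S}, H (archUnitsOfIdele K a,
          fun v : ↥S => (GaloisRepresentations.ideleGroup.finComp v.1).toHomUnits a) ∂ν =
        (c : ℝ) • ∫ p, H p ∂μ := by
  haveI : HasSummableGeomSeries (mixedSpace K) :=
    Literature.MeasureTheory.Group.hasSummableGeomSeries_of_finiteDimensional
  haveI : SecondCountableTopology (ideleGroup K) := secondCountableTopology_ideleGroup K
  haveI : SecondCountableTopology (mixedSpace K)ˣ := Literature.MeasureTheory.Group.Units.secondCountableTopology
  haveI : ∀ v : ↥S, SecondCountableTopology (v.1.adicCompletion K)ˣ := fun v =>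
    secondCountableTopology_units_adicCompletion v.1
  haveI : BorelSpace ((mixedSpace K)ˣ × (∀ v : ↥S, (v.1.adicCompletion K)ˣ)) := Prod.borelSpace
  obtain ⟨c, hc⟩ := exists_map_restrict_ideleUnitBox_compl_eq_smul ν S μ
  have hΘm : Measurable (fun a : ideleGroup K => (archUnitsOfIdele K a,
      fun v : ↥S => (GaloisRepresentations.ideleGroup.finComp v.1).toHomUnits a)) :=
    (continuous_archUnitsOfIdele.prodMk (continuous_pi fun v => continuous_toHomUnits_finComp v.1)).measurable
  refine ⟨c, fun H hH => ?_⟩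
  have hH' : AEStronglyMeasurable H ((ν.restrict (ideleUnitBox {w | w ∉ S})).map
      (fun a : ideleGroup K => (archUnitsOfIdele K a,
        fun v : ↥S => (GaloisRepresentations.ideleGroup.finComp v.1).toHomUnits a))) := by
    rw [hc]
    exact hH.smul_measure _
  rw [← integral_map hΘm.aemeasurable hH', hc, integral_smul_nnreal_measure]
  rfl

/-- **Integrability transfers along `Θ_S`**: if `H` is integrable for the Haar measure `μ` on
`K_∞ˣ × ∏_{v ∈ S} K_vˣ`, then `a ↦ H(Θ_S a)` is integrable on `B(Sᶜ)` for `ν`. [folklore] -/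
theorem integrableOn_ideleUnitBox_compl_comp
    (μ : Measure ((mixedSpace K)ˣ × (∀ v : ↥S, (v.1.adicCompletion K)ˣ))) [IsHaarMeasure μ]
    {E : Type*} [NormedAddCommGroup E] {H : (mixedSpace K)ˣ × (∀ v : ↥S, (v.1.adicCompletion K)ˣ) → E}
    (hH : Integrable H μ) :
    IntegrableOn (fun a : ideleGroup K => H (archUnitsOfIdele K a,
        fun v : ↥S => (GaloisRepresentations.ideleGroup.finComp v.1).toHomUnits a))
      (ideleUnitBox {w | w ∉ S}) ν := by
  haveI : HasSummableGeomSeries (mixedSpace K) :=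
    Literature.MeasureTheory.Group.hasSummableGeomSeries_of_finiteDimensional
  haveI : SecondCountableTopology (ideleGroup K) := secondCountableTopology_ideleGroup K
  haveI : SecondCountableTopology (mixedSpace K)ˣ := Literature.MeasureTheory.Group.Units.secondCountableTopology
  haveI : ∀ v : ↥S, SecondCountableTopology (v.1.adicCompletion K)ˣ := fun v =>
    secondCountableTopology_units_adicCompletion v.1
  haveI : BorelSpace ((mixedSpace K)ˣ × (∀ v : ↥S, (v.1.adicCompletion K)ˣ)) := Prod.borelSpace
  obtain ⟨c, hc⟩ := exists_map_restrict_ideleUnitBox_compl_eq_smul ν S μ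
  have hΘm : Measurable (fun a : ideleGroup K => (archUnitsOfIdele K a,
      fun v : ↥S => (GaloisRepresentations.ideleGroup.finComp v.1).toHomUnits a)) :=
    (continuous_archUnitsOfIdele.prodMk (continuous_pi fun v => continuous_toHomUnits_finComp v.1)).measurable
  have hint : Integrable H ((ν.restrict (ideleUnitBox {w | w ∉ S})).map
      (fun a : ideleGroup K => (archUnitsOfIdele K a,
        fun v : ↥S => (GaloisRepresentations.ideleGroup.finComp v.1).toHomUnits a))) := by
    rw [hc]
    exact hH.smul_measure ENNReal.coe_ne_top
  exact (integrable_map_measure hint.aestronglyMeasurable hΘm.aemeasurable).1 hint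

/-- **Product functions: `∫_{B(Sᶜ)} g(a_∞) ∏_{v ∈ S} h_v(a_v) dν(a) = c · ∫ g dμ_∞ · ∏_{v ∈ S} ∫ h_v dμ_v`**
for Haar measures `μ_∞` on `K_∞ˣ` and `μ_v` on `K_vˣ` (`v ∈ S`) and integrable `g`, `h_v` — the
factorisation of the `S ∪ ∞` part of an idelic integral of a factorizable function into local
integrals (Tate (1967), §4.4, Thm. 4.4.1 for the zeta functions; Fubini on the finite product).
[cite: CasselsFrohlichANT1967, Ch. XV §4.4] -/
theorem exists_setIntegral_ideleUnitBox_compl_prod_eq_mul_prod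
    (μinf : Measure (mixedSpace K)ˣ) [IsHaarMeasure μinf]
    (μv : ∀ v : ↥S, Measure (v.1.adicCompletion K)ˣ) [∀ v, IsHaarMeasure (μv v)] :
    ∃ c : ℝ≥0, ∀ (g : (mixedSpace K)ˣ → ℂ) (h : ∀ v : ↥S, (v.1.adicCompletion K)ˣ → ℂ),
      Integrable g μinf → (∀ v, Integrable (h v) (μv v)) →
      ∫ a in ideleUnitBox {w | w ∉ S}, g (archUnitsOfIdele K a) *
          ∏ v : ↥S, h v ((GaloisRepresentations.ideleGroup.finComp v.1).toHomUnits a) ∂ν =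
        (c : ℂ) * (∫ x, g x ∂μinf) * ∏ v : ↥S, ∫ y, h v y ∂(μv v) := by
  haveI : HasSummableGeomSeries (mixedSpace K) :=
    Literature.MeasureTheory.Group.hasSummableGeomSeries_of_finiteDimensional
  haveI : SecondCountableTopology (ideleGroup K) := secondCountableTopology_ideleGroup K
  haveI : SecondCountableTopology (mixedSpace K)ˣ := Literature.MeasureTheory.Group.Units.secondCountableTopology
  haveI : ∀ v : ↥S, SecondCountableTopology (v.1.adicCompletion K)ˣ := fun v =>
    secondCountableTopology_units_adicCompletion v.1
  haveI : BorelSpace ((mixedSpace K)ˣ × (∀ v : ↥S, (v.1.adicCompletion K)ˣ)) := Prod.borelSpace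
  haveI : MeasurableMul (mixedSpace K)ˣ := ContinuousMul.measurableMul
  haveI : MeasurableMul (∀ v : ↥S, (v.1.adicCompletion K)ˣ) := ContinuousMul.measurableMul
  haveI j1 : (Measure.pi μv).IsHaarMeasure := inferInstance
  haveI j2 : SFinite (Measure.pi μv) := inferInstance
  haveI j3 : SFinite μinf := inferInstance
  haveI j4 : (μinf.prod (Measure.pi μv)).IsHaarMeasure := Measure.prod.instIsHaarMeasure μinf (Measure.pi μv)
  obtain ⟨c, hc⟩ := exists_setIntegral_ideleUnitBox_compl_eq_mul_integral ν S (μinf.prod (Measure.pi μv)) (E := ℂ)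
  refine ⟨c, fun g h hg hh => ?_⟩
  have hG : AEStronglyMeasurable (fun y : ∀ v : ↥S, (v.1.adicCompletion K)ˣ => ∏ v : ↥S, h v (y v))
      (Measure.pi μv) := by
    have h' := Finset.aestronglyMeasurable_prod (Finset.univ : Finset ↥S) fun v _ =>
      (hh v).aestronglyMeasurable.comp_quasiMeasurePreserving (Measure.quasiMeasurePreserving_eval μv v)
    convert h' using 1
    funext y
    simp only [Finset.prod_apply, Function.comp_apply]
  have hH : AEStronglyMeasurable (fun p : (mixedSpace K)ˣ × (∀ v : ↥S, (v.1.adicCompletion K)ˣ) =>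
      g p.1 * ∏ v : ↥S, h v (p.2 v)) (μinf.prod (Measure.pi μv)) :=
    (hg.aestronglyMeasurable.comp_fst).mul hG.comp_snd
  have h1 := hc _ hH
  simp only at h1
  rw [h1, integral_prod_mul (μ := μinf) (ν := Measure.pi μv) g (fun y => ∏ v : ↥S, h v (y v)),
    integral_fintype_prod_eq_prod (𝕜 := ℂ) h]
  rw [Complex.real_smul, mul_assoc]

omit [IsFiniteMeasureOnCompacts ν] [ν.IsMulLeftInvariant] in
/-- **The constant is not zero when `ν` charges open sets** (e.g. `ν` a Haar measure on `𝕀_K`): the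
box `B(Sᶜ)` is a non-empty open set. [folklore] -/
theorem ne_zero_of_map_restrict_ideleUnitBox_compl_eq_smul [ν.IsOpenPosMeasure]
    (μ : Measure ((mixedSpace K)ˣ × (∀ v : ↥S, (v.1.adicCompletion K)ˣ))) {c : ℝ≥0}
    (hc : (ν.restrict (ideleUnitBox {w | w ∉ S})).map
        (fun a => (archUnitsOfIdele K a,
          fun v : ↥S => (GaloisRepresentations.ideleGroup.finComp v.1).toHomUnits a)) = c • μ) :
    c ≠ 0 := by
  haveI : HasSummableGeomSeries (mixedSpace K) :=
    Literature.MeasureTheory.Group.hasSummableGeomSeries_of_finiteDimensional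
  haveI : SecondCountableTopology (ideleGroup K) := secondCountableTopology_ideleGroup K
  haveI : SecondCountableTopology (mixedSpace K)ˣ := Literature.MeasureTheory.Group.Units.secondCountableTopology
  haveI : ∀ v : ↥S, SecondCountableTopology (v.1.adicCompletion K)ˣ := fun v =>
    secondCountableTopology_units_adicCompletion v.1
  haveI : BorelSpace ((mixedSpace K)ˣ × (∀ v : ↥S, (v.1.adicCompletion K)ˣ)) := Prod.borelSpace
  intro h0
  rw [h0, zero_smul] at hc
  have hΘm : Measurable (fun a : ideleGroup K => (archUnitsOfIdele K a,
      fun v : ↥S => (GaloisRepresentations.ideleGroup.finComp v.1).toHomUnits a)) :=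
    (continuous_archUnitsOfIdele.prodMk (continuous_pi fun v => continuous_toHomUnits_finComp v.1)).measurable
  have h := congrArg (fun m => m Set.univ) hc
  simp only [Measure.map_apply hΘm MeasurableSet.univ, Set.preimage_univ, Measure.restrict_apply MeasurableSet.univ,
    Set.univ_inter, Measure.coe_zero, Pi.zero_apply] at h
  -- `B(Sᶜ)` is open and contains `1`
  have hopen : IsOpen (ideleUnitBox (K := K) {w | w ∉ S}) := by
    rw [ideleUnitBox_compl_eq_iUnion (fun v => GaloisRepresentations.HeckeCharacter.uniformizer K v)
      (fun v => GaloisRepresentations.HeckeCharacter.valued_uniformizer v) S]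
    refine isOpen_iUnion fun m => ?_
    exact (GaloisRepresentations.isOpen_unitIdeles K).smul _
  have hone : (1 : ideleGroup K) ∈ ideleUnitBox (K := K) {w | w ∉ S} := fun w _ => by
    rw [Units.val_one]
    exact map_one _
  exact (hopen.measure_pos ν ⟨1, hone⟩).ne' h

end Pushforward

end Literature.NumberTheory.Automorphic

end
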